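import Summits.QuantumFields.YangMills.Theorems.UnitScaleTiltProp7PinnedBiharmonicGreenMatrix
import Summits.QuantumFields.YangMills.Theorems.UnitScaleTiltProp7TorusGreenDictionary
import Summits.QuantumFields.YangMills.Theorems.UnitScaleTiltProp7CentreHarmonicDivDictionary
import Mathlib.Analysis.Normed.Module.Dual
import HarnessLib

/-!
# Route `UnitScaleTilt`, crux K1 «MinimiserStabilityRegPr» (stmt-QuantumFields-19200), route-R E′ path (α′), residue (hK), row (R5): THE `Tor ↔ Site` TRANSPORT OF THE
# PINNED BIHARMONIC GREEN KERNEL — the STRUCTURED Green matrix `G = G_free − U` (free part `Δ⁻²(δ_x − δ_{y₀})`, pinned interpolant `U`) on the B5 carrier `Tor (fine n M)`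
# at lattice constant `1`, and its reading on the record's finest torus `Site P 0` with `laplace c`, pins `range (embIter k)` and the free Laplacian written as a
# difference of the probabilists' torus Green function `torusGreen` — i.e. the displayed rows `hGrep`∕`hG0` of ✓ `…CentreHarmonicInterpKernel.norm_grad_interp_error_le`
# DISCHARGED on `Site P 0`, with the structure the (A) assembly needs to write `Δ_zG(x,·) = ½(G̃(·−x) − G̃(·−y₀)) − ΔU_x`

Cell `ym3-torus`, width seat `ym3-torus-px4` (gen 2); named by ★ym-routeR-w3 g5 19:28:35Z «(R5) the `Tor (fine ℓ M) ↔ Site (F.P K) 0` transport of ✓p659194∕p659572∕p660699 into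
✓p654411's `Site P j` letters (px17 ✓p653777 `EK` kit)», conduct ★★OWNER g28 ACK 77 «(R5) = px4 g2».  THEOREMS ONLY (0 `def`, 0 `sorry`); `--supports stmt-QuantumFields-19200`,
count-neutral.  YM₃ on T³ is a ladder rung (R3), not the Clay problem; nothing here claims the stub, the crux, d = 4 or the gap.

WHY.  ✓ `Prop7PinnedBiharmonicGreenMatrix.exists_pinned_biharmonic_green` (★routeR-w3 g5, (A1)) proves `∃ G` on `Tor (fine n M)` with `G(x, up y) = 0` and
`e(x) = Σ_z G(x,z)(Δ_n²e)(z)`, but its `∃` HIDES the structure `G(x,·) = v_x − u_x` that the kernel estimate (A) needs (`Δ_zG = Δ⁻¹(δ_x − δ_{y₀}) − Δu_x`), it lives at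
lattice constant `n` and on the B5 carrier, while the consumer ✓ `Prop7CentreHarmonicInterpKernel.norm_grad_interp_error_le` and the energy rows (D1)(D2′)(W) live on
`Site P 0` with `laplace c` and pins `range (embIter k)`.  This file re-runs the (A1) construction AT `c = 1` keeping the split, and transports it along px17's
`EK hk : Site P 0 ≃ Tor (fine (L^k) (Mk P k))` composed with the constant translate by the middle offset (`EK (embIter k y) = up y + ι(j_mid)`, ✓ `EK_embIter`).

WHAT IS PROVED (ns `…Theorems.Prop7GreenKernelSiteTransport`).
* §1 (B5 carrier `Tor (fine n M)`, any `d`, `n ≥ 1`, lattice constant `1`): `mulVec_deltaSub` (`(A(δ_x − δ_y))(t) = A t x − A t y`), ★★ `exists_pinned_biharmonic_green_split` —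
  `∃ Gf U G` with `Gf x = Δ₁⁻²(δ_x − δ_{up y₀})`, `G = Gf − U`, `U x (up y) = Gf x (up y)`, `Δ₁²(U x) = 0` off `range up`, `Δ₁(Gf x) = (Δ₁⁻¹)(·, x) − (Δ₁⁻¹)(·, up y₀)`,
  `Δ₁²(Gf x) = δ_x − δ_{up y₀}`, `G x (up y) = 0`, and `e(x) = Σ_z G(x,z)(Δ₁²e)(z)` for every `e` vanishing on `range up`.
* §2 (the dictionary `τ z := EK z − ι(j_mid)` on `Site P 0`): `tau_embIter` (`τ(embIter k y) = up y`), `tau_shift`∕`tau_unshift`, `sum_comp_tau`, `tau_ne_up_of_not_mem`,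
  ★ `laplace_one_re_comp_tau` (`laplace 1 (Re ∘ F ∘ τ) z = Re((Δ₁F)(τ z))`), `laplace_eq_sq_smul_laplace_one` (`laplace c = c²•laplace 1`), `laplace_comp_clm` (`Δ` commutes
  with continuous linear functionals), `LapS_one_ofReal_comp_tauInv` (`Δ₁(e ∘ τ⁻¹) = (laplace 1 e) ∘ τ⁻¹`, from ✓ `LapS_one_mulVec_transl`).
* §3 ★★★ `exists_green_site_split` — on `Site P 0`, for every `c ≠ 0` and every real normed `V`: `∃ Gf Uf G : Site P 0 → Site P 0 → ℝ` with `G = Gf − Uf`,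
  `Uf x (embIter k y) = Gf x (embIter k y)`, `G x y = 0` on `range (embIter k)`, `laplace c (laplace c (Uf x)) = 0` off `range (embIter k)`,
  `laplace c (Gf x) z = (2c²)⁻¹·(G̃(EK z − EK x) − G̃(EK z − EK y_c))` (`G̃ = torusGreen` of period `L^k·sitesPerDir k`, `y_c = embIter k default`),
  `laplace c (laplace c (Gf x)) z = 𝟙[z = x] − 𝟙[z = y_c]`, and the REPRESENTATION `e x = Σ_z G x z • laplace c (laplace c e) z` for every `V`-valued `e` vanishing on the
  centres (scalar case by `Re`, `V`-valued by Hahn–Banach `SeparatingDual.eq_iff_forall_dual_eq`) — the rows `hGrep`, `hG0` of ✓p654411 VERBATIM at `j = 0`, `C := range (embIter k)`.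
HONEST SCOPE.  Linear bookkeeping between two typings of one torus (no estimate): the analytic rows stay where they are — ✓ `torusGreen_grad_mul_dist_sq_le` (N) and
✓ `torusGreen_hessian_mul_dist_cube_le` (Hess3) now read DIRECTLY on `laplace c (Gf b.tgt) z − laplace c (Gf b.src) z` through `EK_shift`; the interpolant part `Uf` is what
(D2′)∕(W) bound on `Site P 0`.  Flat, scalar Green kernel; no Yang–Mills statement is touched.

References: T. Bałaban, CMP 95 (1984) 17–40 [Balaban1984PropagatorsI] (Sect. C p.22, (1.17)–(1.21) pp.20–21); CMP 99 (1985) 75–102 [Balaban1985RegularSpaces] ((1.14) p.78,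
(1.36) p.82); G. F. Lawler, V. Limic, *Random Walk: A Modern Introduction*, CUP 2010, Ch. 4 [LawlerLimic2010].
-/

set_option autoImplicit false

noncomputable section

open scoped BigOperators Matrix ComplexConjugate
open Finset Complex Matrix

namespace Summit.QuantumFields.YangMills.Theorems.Prop7GreenKernelSiteTransport

open Literature.MathematicalPhysics.QuantumFieldTheory.Balaban1983to89
open LatticeFieldCalculus
open B15DeterminingSets (embIter)
open B5Prop11Plancherel (Tor fine unitVec)
open B5Block118 (up iota bpt)
open B5Action121 (LapS LapS_mulVec)
open B5LaplaceInverse (LapSinv LapS_mul_LapSinv_mul_LapSinv LapS_LapSinv_of_orth)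
open B5Eq117TorusCarriers (Mk EK EK_apply)
open Literature.Probability.LatticeModels (torusGreen TorusSite)
open Prop7TorusGreenDictionary (LapSinv_one_apply_eq_half_torusGreen)
open Prop7CentreHarmonicInterpolantFlat (exists_pinned_biharmonic_interpolant)
open Prop7PinnedBiharmonicGreenMatrix (sum_mul_LapS_LapS_comm LapS_LapS_LapSinv_LapSinv_of_orth sum_delta_sub_delta)
open Prop7CentreHarmonicDivDictionary (EK_unshift EK_symm_sub_unitVec EK_embIter LapS_one_mulVec_transl)
open Literature.MathematicalPhysics.QuantumFieldTheory.BalabanImbrieJaffe1984to88.BIJ85Thm711TorusTransport (EK_shift EK_symm_add_unitVec)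

/-! ## §1 The structured pinned biharmonic Green matrix on the B5 carrier, lattice constant `1` -/

section TorSide

variable {d : ℕ}

/-- `(A(δ_x − δ_y))(t) = A t x − A t y`. [folklore] -/
theorem mulVec_deltaSub (N : Fin d → ℕ) [∀ μ, NeZero (N μ)] (A : Matrix (Tor N) (Tor N) ℂ) (x y t : Tor N) :
    (A *ᵥ (fun z => (if z = x then (1 : ℂ) else 0) - (if z = y then (1 : ℂ) else 0))) t = A t x - A t y := by
  classical
  simp only [Matrix.mulVec, dotProduct, mul_sub, Finset.sum_sub_distrib, mul_ite, mul_one, mul_zero, Finset.sum_ite_eq',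
    Finset.mem_univ, if_true]

variable (n : ℕ) [NeZero n] (M : Fin d → ℕ) [hM : ∀ μ, NeZero (M μ)]

/-- ★★ **THE STRUCTURED PINNED BIHARMONIC GREEN MATRIX** (lattice constant `1`; the construction of ✓ `Prop7PinnedBiharmonicGreenMatrix.exists_pinned_biharmonic_green` with the
split `G = G_free − U` EXPORTED): `Gf x := Δ₁⁻²(δ_x − δ_{up y₀})` (mean-zero source), `U x :=` the pinned biharmonic interpolant of `Gf x|_{centres}` (✓ `exists_pinned_biharmonic_interpolant`,
biharmonic for `Δ_n = n²Δ₁` hence for `Δ₁`), `G := Gf − U`; then `G(x, up y) = 0`, `Δ₁(Gf x) = Δ₁⁻¹(·,x) − Δ₁⁻¹(·, up y₀)`, `Δ₁²(Gf x) = δ_x − δ_{up y₀}`, and for every `e`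
vanishing on the centres `e(x) = Σ_z G(x,z)·(Δ₁²e)(z)`. [cite: Balaban1984PropagatorsI, Sect. C p.22; Balaban1985RegularSpaces, (1.14) p.78] -/
theorem exists_pinned_biharmonic_green_split (hn : 1 ≤ n) (y₀ : Tor M) :
    ∃ Gf U G : Tor (fine n M) → Tor (fine n M) → ℂ,
      (∀ x, Gf x = LapSinv (fine n M) 1 *ᵥ (LapSinv (fine n M) 1 *ᵥ
          (fun z => (if z = x then (1 : ℂ) else 0) - (if z = up n M y₀ then (1 : ℂ) else 0))))
      ∧ (∀ x z, G x z = Gf x z - U x z)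
      ∧ (∀ x y, U x (up n M y) = Gf x (up n M y))
      ∧ (∀ x z, (∀ y, z ≠ up n M y) → (LapS (fine n M) 1 *ᵥ (LapS (fine n M) 1 *ᵥ U x)) z = 0)
      ∧ (∀ x z, (LapS (fine n M) 1 *ᵥ Gf x) z = LapSinv (fine n M) 1 z x - LapSinv (fine n M) 1 z (up n M y₀))
      ∧ (∀ x z, (LapS (fine n M) 1 *ᵥ (LapS (fine n M) 1 *ᵥ Gf x)) z = (if z = x then (1 : ℂ) else 0) - (if z = up n M y₀ then (1 : ℂ) else 0))
      ∧ (∀ x y, G x (up n M y) = 0)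
      ∧ ∀ e : Tor (fine n M) → ℂ, (∀ y, e (up n M y) = 0) →
          ∀ x, e x = ∑ z, G x z * (LapS (fine n M) 1 *ᵥ (LapS (fine n M) 1 *ᵥ e)) z := by
  classical
  have hc : (1 : ℂ) ≠ 0 := one_ne_zero
  have hnC : (n : ℂ) ≠ 0 := by exact_mod_cast NeZero.ne n
  set N := fine n M with hN
  set src : Tor N → Tor N → ℂ := fun x z => (if z = x then (1 : ℂ) else 0) - (if z = up n M y₀ then (1 : ℂ) else 0) with hsrc
  set Gf : Tor N → Tor N → ℂ := fun x => LapSinv N 1 *ᵥ (LapSinv N 1 *ᵥ src x) with hGf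
  have hGf2 : ∀ x, LapS N 1 *ᵥ (LapS N 1 *ᵥ Gf x) = src x :=
    fun x => LapS_LapS_LapSinv_LapSinv_of_orth N hc (src x) (sum_delta_sub_delta N x (up n M y₀))
  have hGf1 : ∀ x, LapS N 1 *ᵥ Gf x = LapSinv N 1 *ᵥ src x := fun x => by
    simp only [hGf, Matrix.mulVec_mulVec, ← Matrix.mul_assoc, LapS_mul_LapSinv_mul_LapSinv]
  -- the pinned correction (biharmonic for `Δ_n`, hence for `Δ₁`)
  have hu : ∀ x, ∃ u : Tor N → ℂ, (∀ y, u (up n M y) = Gf x (up n M y))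
      ∧ ∀ z, (∀ y, z ≠ up n M y) → (LapS N (n : ℂ) *ᵥ (LapS N (n : ℂ) *ᵥ u)) z = 0 :=
    fun x => exists_pinned_biharmonic_interpolant n M hn (fun y => Gf x (up n M y))
  choose U hU1 hU2 using hu
  have hscale : ∀ (f : Tor N → ℂ) (z : Tor N),
      (LapS N (n : ℂ) *ᵥ (LapS N (n : ℂ) *ᵥ f)) z = (n : ℂ) ^ 2 * ((n : ℂ) ^ 2 * (LapS N 1 *ᵥ (LapS N 1 *ᵥ f)) z) := by
    intro f z
    have h1 : LapS N (n : ℂ) *ᵥ f = fun t => (n : ℂ) ^ 2 * (LapS N 1 *ᵥ f) t :=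
      funext fun t => Prop7CentreHarmonicDivDictionary.LapS_natCast_mulVec N n f t
    rw [Prop7CentreHarmonicDivDictionary.LapS_natCast_mulVec N n, h1]
    have h2 : (fun t => (n : ℂ) ^ 2 * (LapS N 1 *ᵥ f) t) = ((n : ℂ) ^ 2) • (LapS N 1 *ᵥ f) := rfl
    rw [h2, Matrix.mulVec_smul, Pi.smul_apply, smul_eq_mul]
  have hU2' : ∀ x z, (∀ y, z ≠ up n M y) → (LapS N 1 *ᵥ (LapS N 1 *ᵥ U x)) z = 0 := by
    intro x z hz
    have h := hU2 x z hz
    rw [hscale] at h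
    have hn2 : (n : ℂ) ^ 2 ≠ 0 := pow_ne_zero _ hnC
    rcases mul_eq_zero.1 h with h | h
    · exact absurd h hn2
    rcases mul_eq_zero.1 h with h | h
    · exact absurd h hn2
    exact h
  refine ⟨Gf, U, fun x z => Gf x z - U x z, fun x => rfl, fun x z => rfl, hU1, hU2', ?_, ?_, ?_, ?_⟩
  · intro x z
    rw [hGf1, hsrc, mulVec_deltaSub]
  · intro x z
    rw [hGf2]
  · intro x y
    simp [hU1 x y]
  · intro e he x
    -- move `Δ₁²` onto `G(x,·)`
    have hsym : ∑ z, (Gf x z - U x z) * (LapS N 1 *ᵥ (LapS N 1 *ᵥ e)) z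
        = ∑ z, (LapS N 1 *ᵥ (LapS N 1 *ᵥ (fun w => Gf x w - U x w))) z * e z :=
      sum_mul_LapS_LapS_comm N 1 (fun w => Gf x w - U x w) e
    rw [hsym]
    have hlin : (LapS N 1 *ᵥ (LapS N 1 *ᵥ (fun w => Gf x w - U x w)))
        = fun z => src x z - (LapS N 1 *ᵥ (LapS N 1 *ᵥ U x)) z := by
      have e1 : (fun w => Gf x w - U x w) = Gf x - U x := rfl
      rw [e1, Matrix.mulVec_sub, Matrix.mulVec_sub, hGf2]
      rfl
    rw [hlin]
    simp only [sub_mul, Finset.sum_sub_distrib]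
    have hδ : ∑ z, src x z * e z = e x := by
      simp only [hsrc, sub_mul, Finset.sum_sub_distrib, ite_mul, one_mul, zero_mul, Finset.sum_ite_eq', Finset.mem_univ, if_true]
      rw [he y₀, sub_zero]
    have hUz : ∑ z, (LapS N 1 *ᵥ (LapS N 1 *ᵥ U x)) z * e z = 0 := by
      refine Finset.sum_eq_zero fun z _ => ?_
      by_cases hz : ∃ y, z = up n M y
      · obtain ⟨y, rfl⟩ := hz
        rw [he y, mul_zero]
      · push Not at hz
        rw [hU2' x z hz, zero_mul]
    rw [hδ, hUz, sub_zero]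

end TorSide


/-! ## §2 The dictionary `τ z := EK z − w` between `Site P 0` and the B5 carrier -/

section Dictionary

variable {P : Params} {k : ℕ}

/-- `τ(z + e_μ) = τ z + e_μ`. [cite: Balaban1984PropagatorsI, (1.17) p.20] -/
theorem tau_shift (hk : k ≤ P.m + P.K) (w : Tor (fine (P.L ^ k) (Mk P k))) (z : Site P 0) (μ : Fin P.d) :
    EK hk (z.shift μ) - w = (EK hk z - w) + unitVec (fine (P.L ^ k) (Mk P k)) μ := by
  rw [EK_shift]; abel

/-- `τ(z − e_μ) = τ z − e_μ`. [cite: Balaban1984PropagatorsI, (1.17) p.20] -/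
theorem tau_unshift (hk : k ≤ P.m + P.K) (w : Tor (fine (P.L ^ k) (Mk P k))) (z : Site P 0) (μ : Fin P.d) :
    EK hk (z.unshift μ) - w = (EK hk z - w) - unitVec (fine (P.L ^ k) (Mk P k)) μ := by
  rw [EK_unshift]; abel

/-- `τ` is a bijection: `Σ_{z : Site P 0} F(τ z) = Σ_t F t`. [folklore] -/
theorem sum_comp_tau {α : Type*} [AddCommMonoid α] (hk : k ≤ P.m + P.K) (w : Tor (fine (P.L ^ k) (Mk P k)))
    (F : Tor (fine (P.L ^ k) (Mk P k)) → α) : ∑ z : Site P 0, F (EK hk z - w) = ∑ t, F t :=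
  Equiv.sum_comp ((EK hk).trans (Equiv.subRight w)) F

/-- `τ⁻¹(τ z) = z` in the letters of ✓ `LapS_one_mulVec_transl`: `EK⁻¹((EK z − w) + w) = z`. [folklore] -/
theorem EK_symm_tau_add (hk : k ≤ P.m + P.K) (w : Tor (fine (P.L ^ k) (Mk P k))) (z : Site P 0) :
    (EK hk).symm (EK hk z - w + w) = z := by
  rw [sub_add_cancel, Equiv.symm_apply_apply]

/-- under the centre property `EK (embIter k y) = up y + w`: `τ(embIter k y) = up y`. [cite: Balaban1984PropagatorsI, (1.18) p.20] -/
theorem tau_embIter (hk : k ≤ P.m + P.K) (w : Tor (fine (P.L ^ k) (Mk P k)))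
    (hw : ∀ y : Site P k, EK hk (embIter k y) = up (P.L ^ k) (Mk P k) y + w) (y : Site P k) :
    EK hk (embIter k y) - w = up (P.L ^ k) (Mk P k) y := by
  rw [hw, add_sub_cancel_right]

/-- … and `τ⁻¹(up y) = embIter k y` in the letters of ✓ `LapS_one_mulVec_transl`. [cite: Balaban1984PropagatorsI, (1.18) p.20] -/
theorem EK_symm_up_add (hk : k ≤ P.m + P.K) (w : Tor (fine (P.L ^ k) (Mk P k)))
    (hw : ∀ y : Site P k, EK hk (embIter k y) = up (P.L ^ k) (Mk P k) y + w) (y : Site P k) :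
    (EK hk).symm (up (P.L ^ k) (Mk P k) y + w) = embIter k y := by
  rw [Equiv.symm_apply_eq, hw]

/-- a site off the centres goes off `range up`. [cite: Balaban1984PropagatorsI, (1.18) p.20] -/
theorem tau_ne_up_of_not_mem (hk : k ≤ P.m + P.K) (w : Tor (fine (P.L ^ k) (Mk P k)))
    (hw : ∀ y : Site P k, EK hk (embIter k y) = up (P.L ^ k) (Mk P k) y + w) {z : Site P 0}
    (hz : z ∉ Set.range (embIter k)) (y : Site P k) : EK hk z - w ≠ up (P.L ^ k) (Mk P k) y := by
  intro h
  apply hz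
  refine ⟨y, ?_⟩
  apply (EK hk).injective
  rw [hw, ← h, sub_add_cancel]

/-- `τ` is injective: `τ z = τ x ↔ z = x`. [folklore] -/
theorem tau_eq_tau_iff (hk : k ≤ P.m + P.K) (w : Tor (fine (P.L ^ k) (Mk P k))) (z x : Site P 0) :
    EK hk z - w = EK hk x - w ↔ z = x := by
  rw [sub_left_inj, (EK hk).injective.eq_iff]

/-- the centred translate is provided by ✓ `EK_embIter`: `w = ι(j_mid)`. [cite: Balaban1984PropagatorsI, (1.18) p.20] -/
theorem exists_translate (hk : k ≤ P.m + P.K) :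
    ∃ w : Tor (fine (P.L ^ k) (Mk P k)), ∀ y : Site P k, EK hk (embIter k y) = up (P.L ^ k) (Mk P k) y + w :=
  ⟨iota (P.L ^ k) (Mk P k) (fun _ => ⟨(P.L ^ k - 1) / 2, Prop7CentreHarmonicDivDictionary.half_pred_pow_lt P k⟩),
    fun y => EK_embIter hk y⟩

/-- ★ **`Δ` UNDER `τ` (complex values)**: `laplace 1 (F ∘ τ) z = (Δ₁F)(τ z)`. [cite: Balaban1984PropagatorsI, (1.21) p.21] -/
theorem laplace_one_comp_tau (hk : k ≤ P.m + P.K) (w : Tor (fine (P.L ^ k) (Mk P k)))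
    (F : Tor (fine (P.L ^ k) (Mk P k)) → ℂ) (z : Site P 0) :
    laplace 1 (fun z' : Site P 0 => F (EK hk z' - w)) z = (LapS (fine (P.L ^ k) (Mk P k)) 1 *ᵥ F) (EK hk z - w) := by
  rw [LapS_mulVec]
  simp only [laplace, one_pow, one_smul, map_one, one_mul, tau_shift, tau_unshift]
  refine Finset.sum_congr rfl fun μ _ => ?_
  ring

/-- `laplace 1 (Re ∘ F ∘ τ) z = Re((Δ₁F)(τ z))`. [cite: Balaban1984PropagatorsI, (1.21) p.21] -/
theorem laplace_one_re_comp_tau (hk : k ≤ P.m + P.K) (w : Tor (fine (P.L ^ k) (Mk P k)))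
    (F : Tor (fine (P.L ^ k) (Mk P k)) → ℂ) (z : Site P 0) :
    laplace 1 (fun z' : Site P 0 => (F (EK hk z' - w)).re) z = ((LapS (fine (P.L ^ k) (Mk P k)) 1 *ᵥ F) (EK hk z - w)).re := by
  rw [← laplace_one_comp_tau hk w F z]
  simp only [laplace, one_pow, one_smul, Complex.re_sum, Complex.sub_re, Complex.add_re]

/-- `laplace c = c²•laplace 1` pointwise. [cite: Balaban1984PropagatorsI, (1.21) p.21] -/
theorem laplace_eq_sq_smul_laplace_one {j : ℕ} {V : Type*} [AddCommGroup V] [Module ℝ V] (c : ℝ) (f : SiteField P j V) (z : Site P j) :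
    laplace c f z = c ^ 2 • laplace 1 f z := by
  simp only [laplace, one_pow, one_smul, Finset.smul_sum]

/-- `laplace 1 (a·f) = a·laplace 1 f` pointwise (real scalar functions). [cite: Balaban1984PropagatorsI, (1.21) p.21] -/
theorem laplace_one_const_mul {j : ℕ} (a : ℝ) (f : SiteField P j ℝ) (z : Site P j) :
    laplace 1 (fun x => a * f x) z = a * laplace 1 f z := by
  simp only [laplace, one_pow, one_smul, Finset.mul_sum]
  refine Finset.sum_congr rfl fun μ _ => ?_
  ring

/-- `laplace c` commutes with linear functionals: `laplace c (g ∘ f) z = g (laplace c f z)`. [cite: Balaban1984PropagatorsI, (1.21) p.21] -/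
theorem laplace_comp_clm {j : ℕ} {V : Type*} [NormedAddCommGroup V] [NormedSpace ℝ V] (g : V →L[ℝ] ℝ) (c : ℝ)
    (f : SiteField P j V) (z : Site P j) : laplace c (fun x => g (f x)) z = g (laplace c f z) := by
  simp only [laplace, map_sum, map_smul, map_sub, map_add, smul_eq_mul]

/-- `Δ₁(e ∘ τ⁻¹) = (laplace 1 e) ∘ τ⁻¹` as functions on the B5 carrier (✓ `LapS_one_mulVec_transl`). [cite: Balaban1984PropagatorsI, (1.21) p.21] -/
theorem LapS_one_ofReal_comp_tauInv (hk : k ≤ P.m + P.K) (w : Tor (fine (P.L ^ k) (Mk P k))) (e : SiteField P 0 ℝ) :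
    LapS (fine (P.L ^ k) (Mk P k)) 1 *ᵥ (fun s => ((e ((EK hk).symm (s + w)) : ℝ) : ℂ))
      = fun t => ((laplace 1 e ((EK hk).symm (t + w)) : ℝ) : ℂ) :=
  funext fun t => LapS_one_mulVec_transl hk e w t

end Dictionary

/-! ## §3 ★★★ The structured Green kernel on `Site P 0` -/

section SiteSide

variable {P : Params} {k : ℕ}

/-- ★★★ **THE PINNED BIHARMONIC GREEN KERNEL ON `Site P 0`, WITH ITS SPLIT** — rows `hGrep`∕`hG0` of ✓ `Prop7CentreHarmonicInterpKernel.norm_grad_interp_error_le` at `j = 0`,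
`C := range (embIter k)`, any `c ≠ 0`, any real normed `V`, DISCHARGED, together with: `G = Gf − Uf`; `Uf x` interpolates `Gf x` at the centres and is biharmonic off them;
the free part has `laplace c (Gf x) z = (2c²)⁻¹·(G̃(EK z − EK x) − G̃(EK z − EK y_c))` (`G̃ = torusGreen` of period `L^k·sitesPerDir k`, `y_c = embIter k default`) and
`laplace c (laplace c (Gf x)) = δ_x − δ_{y_c}`.  Transport of §1 along `τ = EK − ι(j_mid)`; scalar case by `Re`, vector case by Hahn–Banach.
[cite: Balaban1984PropagatorsI, Sect. C p.22, (1.17)–(1.21) pp.20–21; Balaban1985RegularSpaces, (1.14) p.78] -/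
theorem exists_green_site_split (hk : k ≤ P.m + P.K) {c : ℝ} (hc : c ≠ 0)
    {V : Type*} [NormedAddCommGroup V] [NormedSpace ℝ V] :
    ∃ Gf Uf G : Site P 0 → Site P 0 → ℝ,
      (∀ x z, G x z = Gf x z - Uf x z)
      ∧ (∀ x (y : Site P k), Uf x (embIter k y) = Gf x (embIter k y))
      ∧ (∀ x, ∀ y ∈ Set.range (embIter k), G x y = 0)
      ∧ (∀ x z, z ∉ Set.range (embIter k) → laplace c (laplace c (Uf x)) z = 0)
      ∧ (∀ x z, laplace c (Gf x) z = (2 * c ^ 2)⁻¹ *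
          (torusGreen (L := P.L ^ k * P.sitesPerDir k) (EK hk z - EK hk x)
            - torusGreen (L := P.L ^ k * P.sitesPerDir k) (EK hk z - EK hk (embIter k default))))
      ∧ (∀ x z, laplace c (laplace c (Gf x)) z = (if z = x then (1 : ℝ) else 0) - (if z = embIter k default then (1 : ℝ) else 0))
      ∧ ∀ e : SiteField P 0 V, (∀ y ∈ Set.range (embIter k), e y = 0) →
          ∀ x, e x = ∑ z, G x z • laplace c (laplace c e) z := by
  classical
  haveI : NeZero (P.L ^ k) := ⟨pow_ne_zero _ P.L_pos.ne'⟩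
  haveI hNZ : NeZero (P.L ^ k * P.sitesPerDir k) := ⟨mul_ne_zero (pow_ne_zero _ P.L_pos.ne') (P.sitesPerDir_ne_zero k)⟩
  have hn : 1 ≤ P.L ^ k := Nat.one_le_pow _ _ P.L_pos
  set n : ℕ := P.L ^ k with hn'
  set M : Fin P.d → ℕ := Mk P k with hM'
  obtain ⟨w, hw⟩ := exists_translate hk
  set y₀ : Site P k := default with hy₀
  obtain ⟨GfT, UT, GT, hGfT, hGT, hU1, hU2, hL1, hL2, hG0, hrep⟩ :=
    exists_pinned_biharmonic_green_split (P.L ^ k) (Mk P k) hn y₀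
  have hc2 : c ^ 2 ≠ 0 := pow_ne_zero _ hc
  have hc4 : c ^ 4 ≠ 0 := pow_ne_zero _ hc
  -- the transported kernels
  set Gf : Site P 0 → Site P 0 → ℝ := fun x z => (c ^ 4)⁻¹ * (GfT (EK hk x - w) (EK hk z - w)).re with hGf
  set Uf : Site P 0 → Site P 0 → ℝ := fun x z => (c ^ 4)⁻¹ * (UT (EK hk x - w) (EK hk z - w)).re with hUf
  set G : Site P 0 → Site P 0 → ℝ := fun x z => (c ^ 4)⁻¹ * (GT (EK hk x - w) (EK hk z - w)).re with hG
  -- `laplace c ∘ laplace c` of a transported kernel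
  have hLL : ∀ (F : Tor (fine (P.L ^ k) (Mk P k)) → Tor (fine (P.L ^ k) (Mk P k)) → ℂ) (x z : Site P 0),
      laplace c (laplace c (fun z' : Site P 0 => (c ^ 4)⁻¹ * (F (EK hk x - w) (EK hk z' - w)).re)) z
        = ((LapS (fine (P.L ^ k) (Mk P k)) 1 *ᵥ (LapS (fine (P.L ^ k) (Mk P k)) 1 *ᵥ F (EK hk x - w))) (EK hk z - w)).re := by
    intro F x z
    have h1 : laplace 1 (fun z' : Site P 0 => (c ^ 4)⁻¹ * (F (EK hk x - w) (EK hk z' - w)).re)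
        = fun z' => (c ^ 4)⁻¹ * ((LapS (fine (P.L ^ k) (Mk P k)) 1 *ᵥ F (EK hk x - w)) (EK hk z' - w)).re := by
      funext z'
      rw [laplace_one_const_mul, laplace_one_re_comp_tau]
    have h2 : laplace c (fun z' : Site P 0 => (c ^ 4)⁻¹ * (F (EK hk x - w) (EK hk z' - w)).re)
        = fun z' => c ^ 2 * ((c ^ 4)⁻¹ * ((LapS (fine (P.L ^ k) (Mk P k)) 1 *ᵥ F (EK hk x - w)) (EK hk z' - w)).re) := by
      funext z'
      rw [laplace_eq_sq_smul_laplace_one, h1, smul_eq_mul]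
    rw [h2, laplace_eq_sq_smul_laplace_one, smul_eq_mul, laplace_one_const_mul, laplace_one_const_mul, laplace_one_re_comp_tau]
    field_simp
  -- `laplace c` of a transported kernel
  have hL : ∀ (F : Tor (fine (P.L ^ k) (Mk P k)) → Tor (fine (P.L ^ k) (Mk P k)) → ℂ) (x z : Site P 0),
      laplace c (fun z' : Site P 0 => (c ^ 4)⁻¹ * (F (EK hk x - w) (EK hk z' - w)).re) z
        = (c ^ 2)⁻¹ * ((LapS (fine (P.L ^ k) (Mk P k)) 1 *ᵥ F (EK hk x - w)) (EK hk z - w)).re := by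
    intro F x z
    rw [laplace_eq_sq_smul_laplace_one, smul_eq_mul, laplace_one_const_mul, laplace_one_re_comp_tau]
    field_simp
  refine ⟨Gf, Uf, G, ?_, ?_, ?_, ?_, ?_, ?_, ?_⟩
  · -- the split
    intro x z
    simp only [hGf, hUf, hG, hGT, Complex.sub_re, mul_sub]
  · -- the interpolant agrees with the free part at the centres
    intro x y
    simp only [hGf, hUf, tau_embIter hk w hw, hU1]
  · -- `G` vanishes at the centres
    rintro x _ ⟨y, rfl⟩
    simp only [hG, tau_embIter hk w hw, hG0, Complex.zero_re, mul_zero]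
  · -- the interpolant is biharmonic off the centres
    intro x z hz
    rw [hUf, hLL UT x z, hU2 _ _ (tau_ne_up_of_not_mem hk w hw hz), Complex.zero_re]
  · -- the free Laplacian is the Green's function difference
    intro x z
    rw [hGf, hL GfT x z, hL1, LapSinv_one_apply_eq_half_torusGreen (d := P.d) (L := P.L ^ k * P.sitesPerDir k),
      ← tau_embIter hk w hw y₀, LapSinv_one_apply_eq_half_torusGreen (d := P.d) (L := P.L ^ k * P.sitesPerDir k),
      sub_sub_sub_cancel_right, sub_sub_sub_cancel_right, ← Complex.ofReal_sub, Complex.ofReal_re]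
    ring
  · -- the free bi-Laplacian is the dipole of deltas
    intro x z
    rw [hGf, hLL GfT x z, hL2, ← tau_embIter hk w hw y₀]
    simp only [tau_eq_tau_iff, Complex.sub_re, apply_ite Complex.re, Complex.one_re, Complex.zero_re]
  · -- the representation: scalar case by `Re`, then Hahn–Banach
    have hscalar : ∀ e : SiteField P 0 ℝ, (∀ y ∈ Set.range (embIter k), e y = 0) →
        ∀ x, e x = ∑ z, G x z * laplace c (laplace c e) z := by
      intro e he x
      set eT : Tor (fine (P.L ^ k) (Mk P k)) → ℂ := fun s => ((e ((EK hk).symm (s + w)) : ℝ) : ℂ) with heT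
      have heT0 : ∀ y, eT (up (P.L ^ k) (Mk P k) y) = 0 := fun y => by
        simp only [heT, EK_symm_up_add hk w hw, he _ ⟨y, rfl⟩, Complex.ofReal_zero]
      have h := hrep eT heT0 (EK hk x - w)
      have hx : eT (EK hk x - w) = ((e x : ℝ) : ℂ) := by simp only [heT, EK_symm_tau_add]
      have hΔ : LapS (fine (P.L ^ k) (Mk P k)) 1 *ᵥ (LapS (fine (P.L ^ k) (Mk P k)) 1 *ᵥ eT)
          = fun t => ((laplace 1 (laplace 1 e) ((EK hk).symm (t + w)) : ℝ) : ℂ) := by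
        rw [heT, LapS_one_ofReal_comp_tauInv, LapS_one_ofReal_comp_tauInv]
      rw [hx, hΔ, ← sum_comp_tau hk w] at h
      simp only [EK_symm_tau_add] at h
      have h' := congrArg Complex.re h
      rw [Complex.ofReal_re, Complex.re_sum] at h'
      rw [h']
      have hcc : ∀ z, laplace c (laplace c e) z = c ^ 4 * laplace 1 (laplace 1 e) z := by
        intro z
        have e1 : laplace c e = fun x => c ^ 2 * laplace 1 e x := funext fun x => by
          rw [laplace_eq_sq_smul_laplace_one, smul_eq_mul]
        rw [laplace_eq_sq_smul_laplace_one, smul_eq_mul, e1, laplace_one_const_mul]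
        ring
      refine Finset.sum_congr rfl fun z _ => ?_
      rw [Complex.re_mul_ofReal, hcc z, hG]
      beta_reduce
      field_simp
    intro e he x
    refine (SeparatingDual.eq_iff_forall_dual_eq (R := ℝ)).2 fun g => ?_
    have hg := hscalar (fun x => g (e x)) (fun y hy => by simp only [he y hy, map_zero]) x
    rw [hg]
    simp only [map_sum, map_smul, smul_eq_mul]
    refine Finset.sum_congr rfl fun z _ => ?_
    have e1 : laplace c (fun x => g (e x)) = fun x => g (laplace c e x) := funext fun x => laplace_comp_clm g c e x
    rw [e1, laplace_comp_clm]

end SiteSide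

end Summit.QuantumFields.YangMills.Theorems.Prop7GreenKernelSiteTransport
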